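import Mathlib
import Summits.KontsevichZagierPeriods.Zeta5Search.FourthOrderAggregate5
import Summits.KontsevichZagierPeriods.Zeta5Search.FourthDigitWProof
import Summits.KontsevichZagierPeriods.Zeta5Search.FourthDigitVProof
import Summits.KontsevichZagierPeriods.Zeta5Search.FourthOrderResidue
import HarnessLib

/-!
# ζ(5) search — THEOREM L5 (`SecondResidueLaw.LawA5`, gen-2 g14) IS A THEOREM: `v_p(Cas_j(b)) ≥ 8 − 2M`

Cell `pub-zeta5` (HONEST FRAMING: systematic search; no irrationality claim unless certified), typer seat generation 13.
Discharges BY NAME `SecondResidueLaw.LawA5` of `Zeta5Search/SecondResidueLaw.lean` (REPORT-gen2-g14 §4, THEOREM L5): under the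
class clauses `LawA4Classes ∧ ShapeClause` of a frame `(M, T)` for `b` and `b + e_j` (`M ≥ 10` even, `T` palindromic, big prime
`p ≤ b₀ < p² − 2`, `p(M − 4) ≤ 2d + 1`), the Casoratian gains a FIFTH order of magnitude: `v_p(Cas_j(b)) ≥ 8 − 2M = casLB + 5`.
Two cases.  (A) Some live class of `b` or `b + e_j` lies below the top layer: then the frame exponent is `E(T) = −M`
(`typeExp_frame_or_top`) and `L(T) < p`, so `aggregate₅` (frame functionals + classwise digits `fourthDigitW_holds`,
`fourthDigitV_holds` of gen-2 g15 + reflection, odd part and the LIVE RESIDUE LAW `liveKappaSum_small` of gen-2 g15: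
`Σ_{x live} ĝ_x κ_{3−i}(x) ≡ 0 (mod p)` by the residue theorem over `𝔽_p`) gives `2(w, v) ≡ A·t₁`, `2(w', v') ≡ A'·t₁ (mod p⁴)` with
ONE direction `t₁` and `‖A‖, ‖A'‖ ≤ p⁻¹`; the `2 × 2` minor then vanishes to order `p⁵` (`det₅`).  (B) Otherwise every multipole class
of both vectors has `E ≥ −M + 3`, and the crude class bounds (`CellD.padicNorm_classW_le`, `padicNorm_classV_le_of`) already give
`‖w‖, ‖v‖ ≤ p⁻³` (`coeff_norm_of_top`), hence the minor is `O(p⁶)`.  With `Cas = (−p)^{3−2M}(w'v − wv')`: `v_p(Cas) ≥ 8 − 2M`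
(`lawA5_of_residueLaw` with the residue law as a hypothesis of the verbatim shape of `liveKappaSum_small`; `lawA5_holds`).
`p`-adic valuations of rational numbers; nothing here bears on irrationality.
-/

noncomputable section

open Finset PowerSeries

namespace Summit.KontsevichZagierPeriods.Zeta5Search.SecondOrder

open Summit.KontsevichZagierPeriods.Zeta5Search.WedgeDictionary (coeffW coeffV dOf)
open Summit.KontsevichZagierPeriods.Zeta5Search.CasoratianValuation (InPolytope shift casoratian)
open Summit.KontsevichZagierPeriods.Zeta5Search.ClusterValuation
open Summit.KontsevichZagierPeriods.Zeta5Search.PadicSeries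
open Summit.KontsevichZagierPeriods.Zeta5Search.CellA (classW coeffW_eq_sum_classW padicNorm_p)
open Summit.KontsevichZagierPeriods.Zeta5Search.LevelClass (typeExp)
open Summit.KontsevichZagierPeriods.Zeta5Search.BigPrime (shift_zero padicNorm_mul_le_one dOf_shift)
open Summit.KontsevichZagierPeriods.Zeta5Search.RecordWindowsA4 (LawA4Classes)
open Summit.KontsevichZagierPeriods.Zeta5Search.SecondResidueLaw (LawA5 ShapeClause FourthDigitW FourthDigitV)

variable {p : ℕ} [hp : Fact p.Prime]

/-! ## §1 The determinant estimate at order five -/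

/-- **Fourth-order collinearity kills four digits**: if `2w ≡ At_W`, `2v ≡ At_V`, `2w' ≡ A't_W`, `2v' ≡ A't_V (mod p⁴)` with
`‖At‖, ‖A't‖ ≤ p⁻¹` (componentwise), then `‖w'v − wv'‖ ≤ p⁻⁵`. -/
theorem det₅ (hp2 : p ≠ 2) {w v w' v' A A' tW tV : ℚ}
    (hw : padicNorm p (2 * w - A * tW) ≤ (p : ℚ) ^ (-(4 : ℤ))) (hv : padicNorm p (2 * v - A * tV) ≤ (p : ℚ) ^ (-(4 : ℤ)))
    (hw' : padicNorm p (2 * w' - A' * tW) ≤ (p : ℚ) ^ (-(4 : ℤ))) (hv' : padicNorm p (2 * v' - A' * tV) ≤ (p : ℚ) ^ (-(4 : ℤ)))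
    (hAW : padicNorm p (A * tW) ≤ (p : ℚ) ^ (-(1 : ℤ))) (hAV : padicNorm p (A * tV) ≤ (p : ℚ) ^ (-(1 : ℤ)))
    (hAW' : padicNorm p (A' * tW) ≤ (p : ℚ) ^ (-(1 : ℤ))) (hAV' : padicNorm p (A' * tV) ≤ (p : ℚ) ^ (-(1 : ℤ))) :
    padicNorm p (w' * v - w * v') ≤ (p : ℚ) ^ (-(5 : ℤ)) := by
  have h4 : padicNorm p ((1 : ℚ) / 4) = 1 := by
    rw [show ((1 : ℚ) / 4) = 1 / (2 * 2) by norm_num, padicNorm.div, padicNorm.one, padicNorm.mul, padicNorm_two hp2]; norm_num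
  have hexp : w' * v - w * v' = (1 : ℚ) / 4 *
      (((2 * w' - A' * tW) * (2 * v - A * tV) - (2 * w - A * tW) * (2 * v' - A' * tV))
        + ((2 * w' - A' * tW) * (A * tV) + (A' * tW) * (2 * v - A * tV) - (2 * w - A * tW) * (A' * tV)
            - (A * tW) * (2 * v' - A' * tV))) := by ring
  rw [hexp, padicNorm.mul, h4, one_mul]
  have hrr : ∀ {a c : ℚ}, padicNorm p a ≤ (p : ℚ) ^ (-(4 : ℤ)) → padicNorm p c ≤ (p : ℚ) ^ (-(4 : ℤ)) →
      padicNorm p (a * c) ≤ (p : ℚ) ^ (-(5 : ℤ)) := fun ha hc => fo_weak (fo_mul ha hc) (by norm_num)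
  have hra : ∀ {a c : ℚ}, padicNorm p a ≤ (p : ℚ) ^ (-(4 : ℤ)) → padicNorm p c ≤ (p : ℚ) ^ (-(1 : ℤ)) →
      padicNorm p (a * c) ≤ (p : ℚ) ^ (-(5 : ℤ)) := fun ha hc => by
    have h := fo_mul ha hc; rwa [show (-((4 : ℤ) + 1)) = -5 by norm_num] at h
  have har : ∀ {a c : ℚ}, padicNorm p a ≤ (p : ℚ) ^ (-(1 : ℤ)) → padicNorm p c ≤ (p : ℚ) ^ (-(4 : ℤ)) →
      padicNorm p (a * c) ≤ (p : ℚ) ^ (-(5 : ℤ)) := fun ha hc => by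
    have h := fo_mul ha hc; rwa [show (-((1 : ℤ) + 4)) = -5 by norm_num] at h
  exact fo_add (fo_sub (hrr hw' hv) (hrr hw hv'))
    (fo_sub (fo_sub (fo_add (hra hw' hAV) (har hAW' hv)) (hra hw hAV')) (har hAW hv'))

/-! ## §2 The top-layer case: crude bounds suffice -/

/-- **If every multipole class has `E ≥ −M + 3`, then `‖W‖ ≤ p^{M−6}` and `‖V‖ ≤ p^{M−3}`.** -/
theorem coeff_norm_of_top (b : ℕ → ℤ) (hb : InPolytope b) (hp5 : 5 ≤ p) (hwin : (b 0 + 2 : ℤ) < (p : ℤ) ^ 2) {M : ℕ}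
    (hM : 10 ≤ M) (hall : ∀ x < p, 2 ≤ classPoleCount b p x → -(M : ℤ) + 3 ≤ classExp b p x) :
    padicNorm p (coeffW b) ≤ (p : ℚ) ^ (-((-(M : ℤ) + 3) + 3)) ∧ padicNorm p (coeffV b) ≤ (p : ℚ) ^ (-(-(M : ℤ) + 3)) := by
  have hp0 : 0 < p := hp.out.pos
  refine ⟨?_, ?_⟩
  · rw [coeffW_eq_sum_classW b hp0]
    exact padicNorm.sum_le' (fun x hx => CellD.padicNorm_classW_le b hb hp5 hwin (by omega) (hall x (mem_range.1 hx)))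
      (zpow_p_nonneg _)
  · rw [coeffV_eq_sum_classV b hp0]
    refine padicNorm.sum_le' (fun x hx => ?_) (zpow_p_nonneg _)
    have hx' := mem_range.1 hx
    refine CellD.padicNorm_classV_le_of b hb hp5 hwin hx' fun h1 => ?_
    by_cases h2 : 2 ≤ classPoleCount b p x
    · exact (hall x hx' h2).trans (CellA.classExp_le_classNu b p x)
    · have hE6 := ResidueFour.neg_six_le_classExp_of_classPoleCount_le_one b p x (by omega)
      by_cases hνE : classNu b p x = classExp b p x
      · rw [hνE]; omega
      · have := (tame_of_classNu_ne b hνE).2; omega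

/-! ## §3 THEOREM L5 modulo the live residue law -/

/-- **THEOREM L5 (`LawA5`) from the live residue law** `Σ_{x live} ĝ_x κ_{3−i}(x) ≡ 0 (mod p)` (hypothesis `hR`, the exact
signature of gen-2 g15's `liveKappaSum_small` in the cell's vocabulary `liveSet`/`liveKappa`). -/
theorem lawA5_of_residueLaw
    (hR : ∀ (b : ℕ → ℤ) (p : ℕ) [Fact p.Prime] (M : ℕ), InPolytope b → 5 ≤ p → (p : ℤ) ≤ b 0 → (b 0 + 2 : ℤ) < (p : ℤ) ^ 2 →
      10 ≤ M → Even M → (∀ x ∈ multipoleClasses b p, -(M : ℤ) ≤ classExp b p x) →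
      (p : ℤ) * ((M : ℤ) - 4) ≤ 2 * dOf b + 3 →
      padicNorm p (∑ x ∈ liveSet b p M, liveKappa b p M x) ≤ (p : ℚ) ^ (-(1 : ℤ))) : LawA5 := by
  intro b p j M T hb hb' hj1 hj7 hprime hp5 hpb hwin hM hMe hT hC hC' hS hS' hdeg hcas
  haveI : Fact p.Prime := ⟨hprime⟩
  have hp0 : (p : ℚ) ≠ 0 := Nat.cast_ne_zero.2 hprime.ne_zero
  have hpneg : (-(p : ℚ)) ≠ 0 := neg_ne_zero.2 hp0
  have hp2 : p ≠ 2 := by omega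
  have hpb' : (p : ℤ) ≤ shift b j 0 := by rw [shift_zero b hj1]; exact hpb
  have hwin' : (shift b j 0 + 2 : ℤ) < (p : ℤ) ^ 2 := by rw [shift_zero b hj1]; exact hwin
  -- the minor `w'v − wv'` is `O(p⁵)`
  have hdet : padicNorm p (coeffW (shift b j) / (-(p : ℚ)) ^ (-(M : ℤ) + 3) * (coeffV b / (-(p : ℚ)) ^ (-(M : ℤ)))
      - coeffW b / (-(p : ℚ)) ^ (-(M : ℤ) + 3) * (coeffV (shift b j) / (-(p : ℚ)) ^ (-(M : ℤ)))) ≤ (p : ℚ) ^ (-(5 : ℤ)) := by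
    by_cases hA : ∃ x < p, (2 ≤ classPoleCount b p x ∧ classExp b p x ≤ -(M : ℤ) + 2) ∨
        (2 ≤ classPoleCount (shift b j) p x ∧ classExp (shift b j) p x ≤ -(M : ℤ) + 2)
    · -- (A) a live class below the top layer: `E(T) = −M`, `L(T) < p`, collinearity mod `p⁴`
      obtain ⟨x, hx, hx'⟩ := hA
      have hTL : typeExp (tTop T) (tList T) = -(M : ℤ) ∧ tTop T < p := by
        rcases hx' with ⟨h2, hE⟩ | ⟨h2, hE⟩
        · refine ⟨(typeExp_frame_or_top b hb hp5 hpb hMe hT hC hx h2 (by omega)).resolve_right (by omega), ?_⟩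
          obtain ⟨a, hdom⟩ := live_dominates b hpb hC hS hx h2 (by omega)
          have := hdom.le; have := topLevel_lt b hb hwin x; omega
        · refine ⟨(typeExp_frame_or_top (shift b j) hb' hp5 hpb' hMe hT hC' hx h2 (by omega)).resolve_right (by omega), ?_⟩
          obtain ⟨a, hdom⟩ := live_dominates (shift b j) hpb' hC' hS' hx h2 (by omega)
          have := hdom.le; have := topLevel_lt (shift b j) hb' hwin' x; omega
      obtain ⟨hTM, hLp⟩ := hTL
      have hres := hR b p M hb hp5 hpb hwin hM hMe hC.1 (by omega)
      have hres' := hR (shift b j) p M hb' hp5 hpb' hwin' hM hMe hC'.1 (by rw [dOf_shift b hj1 hj7]; omega)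
      obtain ⟨A, hA1, hW, hV⟩ :=
        aggregate₅ b hb hp5 hpb hwin hM hMe hT hC hS fourthDigitW_holds fourthDigitV_holds hTM hres
      obtain ⟨A', hA1', hW', hV'⟩ :=
        aggregate₅ (shift b j) hb' hp5 hpb' hwin' hM hMe hT hC' hS' fourthDigitW_holds fourthDigitV_holds hTM hres'
      have ht := padicNorm_frameT_le_one hp2 hLp (tList T) 1
      exact det₅ hp2 hW hV hW' hV' (padicNorm_mul_le_left hA1 ht.1) (padicNorm_mul_le_left hA1 ht.2)
        (padicNorm_mul_le_left hA1' ht.1) (padicNorm_mul_le_left hA1' ht.2)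
    · -- (B) every multipole class of both vectors has `E ≥ −M + 3`: crude bounds
      have hall : ∀ x < p, 2 ≤ classPoleCount b p x → -(M : ℤ) + 3 ≤ classExp b p x := fun x hx h2 => by
        by_contra h; exact hA ⟨x, hx, Or.inl ⟨h2, by omega⟩⟩
      have hall' : ∀ x < p, 2 ≤ classPoleCount (shift b j) p x → -(M : ℤ) + 3 ≤ classExp (shift b j) p x :=
        fun x hx h2 => by
          by_contra h; exact hA ⟨x, hx, Or.inr ⟨h2, by omega⟩⟩
      obtain ⟨hWb, hVb⟩ := coeff_norm_of_top b hb hp5 hwin hM hall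
      obtain ⟨hWb', hVb'⟩ := coeff_norm_of_top (shift b j) hb' hp5 hwin' hM hall'
      have hw := norm_div_neg_p_zpow hWb
      have hv := norm_div_neg_p_zpow hVb
      have hw' := norm_div_neg_p_zpow hWb'
      have hv' := norm_div_neg_p_zpow hVb'
      exact fo_sub (fo_weak (fo_mul hw' hv) (by norm_num)) (fo_weak (fo_mul hw hv') (by norm_num))
  -- the Casoratian
  set w := coeffW b / (-(p : ℚ)) ^ (-(M : ℤ) + 3)
  set v := coeffV b / (-(p : ℚ)) ^ (-(M : ℤ))
  set w' := coeffW (shift b j) / (-(p : ℚ)) ^ (-(M : ℤ) + 3)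
  set v' := coeffV (shift b j) / (-(p : ℚ)) ^ (-(M : ℤ))
  have hcasE : casoratian b j = (-(p : ℚ)) ^ (-(M : ℤ) + 3) * (-(p : ℚ)) ^ (-(M : ℤ)) * (w' * v - w * v') := by
    have e1 : coeffW b = w * (-(p : ℚ)) ^ (-(M : ℤ) + 3) := by
      simp only [w]; rw [div_mul_cancel₀ _ (zpow_ne_zero _ hpneg)]
    have e2 : coeffV b = v * (-(p : ℚ)) ^ (-(M : ℤ)) := by
      simp only [v]; rw [div_mul_cancel₀ _ (zpow_ne_zero _ hpneg)]
    have e3 : coeffW (shift b j) = w' * (-(p : ℚ)) ^ (-(M : ℤ) + 3) := by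
      simp only [w']; rw [div_mul_cancel₀ _ (zpow_ne_zero _ hpneg)]
    have e4 : coeffV (shift b j) = v' * (-(p : ℚ)) ^ (-(M : ℤ)) := by
      simp only [v']; rw [div_mul_cancel₀ _ (zpow_ne_zero _ hpneg)]
    unfold casoratian
    rw [e1, e2, e3, e4]; ring
  apply val_ge_of_padicNorm_le hcas
  rw [hcasE, padicNorm.mul, padicNorm.mul, LevelClass.padicNorm_neg_p_zpow, LevelClass.padicNorm_neg_p_zpow]
  calc (p : ℚ) ^ (-(-(M : ℤ) + 3)) * (p : ℚ) ^ (-(-(M : ℤ))) * padicNorm p (w' * v - w * v')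
      ≤ (p : ℚ) ^ (-(-(M : ℤ) + 3)) * (p : ℚ) ^ (-(-(M : ℤ))) * (p : ℚ) ^ (-(5 : ℤ)) :=
        mul_le_mul_of_nonneg_left hdet (mul_nonneg (zpow_p_nonneg _) (zpow_p_nonneg _))
    _ = (p : ℚ) ^ (-((8 : ℤ) - 2 * M)) := by
        rw [← zpow_add₀ hp0, ← zpow_add₀ hp0]; congr 1; ring

/-! ## §4 THEOREM L5 -/

/-- **THEOREM L5 (`LawA5`, gen-2 g14) is a theorem.** -/
theorem lawA5_holds : LawA5 :=
  lawA5_of_residueLaw fun b _ _ _ hb hp5 hpn hwin hM hMe H1 hdeg => liveKappaSum_small b hb hp5 hpn hwin hM hMe H1 hdeg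

end Summit.KontsevichZagierPeriods.Zeta5Search.SecondOrder

end
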